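import Summits.QuantumFields.YangMills.Theorems.ColdStartUniversalityLatticeLangevinLiebRobinsonThreePointClustering
import HarnessLib

/-!
# Route `ColdStartUniversality` (fixed-cut-off SZZ dynamics; LIEB–ROBINSON / LOCALITY package, file 30):
# ★★ LOOP–PLAQUETTE–PLAQUETTE THIRD CUMULANTS DECAY IN THE MIDDLE DISTANCE, UNIFORMLY IN THE VOLUME

Helper file (seat `ym-line-csu-p1`, g31; `--supports stmt-QuantumFields-24809`).  For a loop word `w`, plaquettes `q, q'` of `(ℤ/L)³` and
`μ = μ_(β')`, `|β'| < 1/12`, the third cumulant `T(q,q') = ⟨W̃ P̃_q P̃_q'⟩_μ` (`X̃ = X − ⟨X⟩_μ`, `P_q = Re tr U_q`) is bounded by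
`B·e^(−κ d)`, `B = 4096π²(|w|²+8)(2/ρ)e^(2κ)`, `κ = ρ log 108/(2(λ+ρ))`, whenever `d` is at most
* the distances from `w` and from `q` to `q'` (`threePoint_isolate_right`: file 29 with `w₃ = P_q'`), or
* the distances from `q` and from `q'` to `w` (`threePoint_isolate_loop`: file 29 with `w₃ = w`),
distances being cyclic sup-distances between base sites (`torusDist_plaquette_base_le` does the one-step bookkeeping for plaquette links).
File 31 sums these bounds over all pairs `(q, q')`.  THEOREMS ONLY, no definition, no sorry; [folklore].  HONEST FRAMING: fixed cut-off,
strong-coupling window; nothing about `β'_K → ∞`; `UniformColdStartMixing` (24809) is NOT restated; no crux, rung or summit statement is proved;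
the Yang–Mills mass gap is NOT proved.
-/

set_option autoImplicit false

noncomputable section

namespace Summit.QuantumFields.YangMills.Theorems.ColdStartUniversality.LiebRobinson

open MeasureTheory ProbabilityTheory Matrix Complex Finset Filter Set Metric Function
open scoped ComplexConjugate BigOperators Matrix NNReal ENNReal Topology
open Literature.Probability.Process Literature.MathematicalPhysics.QuantumFieldTheory
open Literature.MathematicalPhysics.QuantumFieldTheory.Balaban1983to89
open Literature.MathematicalPhysics.QuantumLattice (fundamentalRep fundamentalLatticeRep continuous_fundamentalRep fundamentalRep_apply)

variable {L : ℕ} [NeZero L]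

/-- The base site of every link of the plaquette `q` is within sup-distance `1` of the base site of `q`:
`D(y_q, x) ≤ D(e, x) + 1` for every link `e` of `q` and every site `x`. [folklore] -/
theorem torusDist_plaquette_base_le (q : Plaquette 3 L) (x : Literature.MathematicalPhysics.QuantumFieldTheory.Site 3 L) :
    ∀ e ∈ ([((q.1, q.2.1.1), false), ((Literature.MathematicalPhysics.QuantumFieldTheory.Site.shift q.1 q.2.1.1, q.2.1.2), false), ((Literature.MathematicalPhysics.QuantumFieldTheory.Site.shift q.1 q.2.1.2, q.2.1.1), true), ((q.1, q.2.1.2), true)].map Prod.fst).toFinset, (Finset.univ.sup fun i : Fin 3 => ((q.1 i - x i).valMinAbs).natAbs) ≤ (Finset.univ.sup fun i : Fin 3 => ((e.1 i - x i).valMinAbs).natAbs) + 1 := by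
  classical
  intro e he
  simp only [List.map, List.mem_toFinset, List.mem_cons, or_false, List.not_mem_nil] at he
  rcases he with h | h | h | h <;> rw [h] <;> dsimp only
  · exact Nat.le_succ _
  · exact torusDist_le_add_succ x q.1 _ (natAbs_valMinAbs_single_le q.2.1.1)
  · exact torusDist_le_add_succ x q.1 _ (natAbs_valMinAbs_single_le q.2.1.2)
  · exact Nat.le_succ _

omit [NeZero L] in
/-- The crossover bookkeeping: `(1 + T_m)e^(−ρT_m) ≤ (2/ρ)·e^(2κ)·e^(−κ(m+3))`, `κ = ρ log 108/(2(λ+ρ))`, `T_m = (m+1) log 108/(λ+ρ)`. [folklore] -/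
theorem crossover_decay_le (β' : ℝ) (hβ : |β'| < 1 / 12) (m : ℕ) :
    (1 + (((m : ℝ) + 1) * Real.log 108 / ((1300 + 4 * Real.sqrt 2) * |β'| + (1 - 12 * |β'|)))) * Real.exp (-((1 - 12 * |β'|) * (((m : ℝ) + 1) * Real.log 108 / ((1300 + 4 * Real.sqrt 2) * |β'| + (1 - 12 * |β'|))))) ≤ (2 / (1 - 12 * |β'|)) * Real.exp (2 * ((1 - 12 * |β'|) * Real.log 108 / (2 * ((1300 + 4 * Real.sqrt 2) * |β'| + (1 - 12 * |β'|))))) * Real.exp (-(((1 - 12 * |β'|) * Real.log 108 / (2 * ((1300 + 4 * Real.sqrt 2) * |β'| + (1 - 12 * |β'|)))) * (m + 3 : ℕ))) := by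
  have hlam0 : 0 ≤ (1300 + 4 * Real.sqrt 2) * |β'| := by positivity
  have hrho : 0 < (1 - 12 * |β'|) := by linarith
  have hden : 0 < (1300 + 4 * Real.sqrt 2) * |β'| + (1 - 12 * |β'|) := by linarith
  have h1 := one_add_mul_exp_neg_le (((m : ℝ) + 1) * Real.log 108 / ((1300 + 4 * Real.sqrt 2) * |β'| + (1 - 12 * |β'|))) hrho (by linarith [abs_nonneg β'])
  refine h1.trans (le_of_eq ?_)
  rw [mul_assoc, ← Real.exp_add]
  congr 2
  push_cast
  field_simp
  ring

/-- ★★ **Isolating the far plaquette**: if the base site of `q'` is at sup-distance `≥ d` from the base site of every link of `w` and from the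
base site of `q`, then `|⟨W̃ P̃_q P̃_q'⟩_(μ_β')| ≤ 4096π²(|w|²+8)(2/ρ)e^(2κ)·e^(−κd)` (`|β'| < 1/12`, every `L`). [folklore] -/
theorem threePoint_isolate_right (L : ℕ) [NeZero L] (β' : ℝ) (hβ : |β'| < 1 / 12) (l₁ : List (Edge 3 L × Bool)) (q q' : Plaquette 3 L) (d : ℕ)
    (hdW : ∀ e' ∈ (l₁.map Prod.fst).toFinset, d ≤ (Finset.univ.sup fun i : Fin 3 => ((e'.1 i - q'.1 i).valMinAbs).natAbs)) (hdq : d ≤ (Finset.univ.sup fun i : Fin 3 => ((q.1 i - q'.1 i).valMinAbs).natAbs)) :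
    let coords : GaugeConfig 3 L (Matrix.specialUnitaryGroup (Fin 2) ℂ) → (Edge 3 L × Fin 2 × Fin 2 × Bool → ℝ) :=
      fun V q => (fun z : ℂ => if q.2.2.2 then z.im else z.re)
        ((fundamentalRep (Fin 2) (V q.1) : Matrix (Fin 2) (Fin 2) ℂ) q.2.1 q.2.2.1)
    |∫ x, ((fun y : (Edge 3 L × Fin 2 × Fin 2 × Bool → ℝ) => ((l₁.map (fun a : Edge 3 L × Bool => if a.2 then ((fun (ee : Edge 3 L) => Matrix.of fun (i j : Fin 2) => ((y (ee, i, j, false) : ℝ) : ℂ) + ((y (ee, i, j, true) : ℝ) : ℂ) * Complex.I) a.1)ᴴ else (fun (ee : Edge 3 L) => Matrix.of fun (i j : Fin 2) => ((y (ee, i, j, false) : ℝ) : ℂ) + ((y (ee, i, j, true) : ℝ) : ℂ) * Complex.I) a.1)).prod).trace.re) (coords x) - ∫ x, (fun y : (Edge 3 L × Fin 2 × Fin 2 × Bool → ℝ) => ((l₁.map (fun a : Edge 3 L × Bool => if a.2 then ((fun (ee : Edge 3 L) => Matrix.of fun (i j : Fin 2) => ((y (ee, i, j, false) : ℝ) :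 ℂ) + ((y (ee, i, j, true) : ℝ) : ℂ) * Complex.I) a.1)ᴴ else (fun (ee : Edge 3 L) => Matrix.of fun (i j : Fin 2) => ((y (ee, i, j, false) : ℝ) : ℂ) + ((y (ee, i, j, true) : ℝ) : ℂ) * Complex.I) a.1)).prod).trace.re) (coords x) ∂(wilsonMeasure (d := 3) (L := L) (fundamentalRep (Fin 2)) β')) * ((fun y : (Edge 3 L × Fin 2 × Fin 2 × Bool → ℝ) => (([((q.1, q.2.1.1), false), ((Literature.MathematicalPhysics.QuantumFieldTheory.Site.shift q.1 q.2.1.1, q.2.1.2), false), ((Literature.MathematicalPhysics.QuantumFieldTheory.Site.shift q.1 q.2.1.2, q.2.1.1), true), ((q.1, q.2.1.2), true)].map (fun a : Edge 3 L × Bool => if a.2 then ((fun (ee : Edge 3 L) => Matrix.of fun (i j : Fin 2) => ((y (ee, i, j, false) : ℝ) : ℂ) + ((y (ee, i, j, true) : ℝ) : ℂ) * Complex.I) a.1)ᴴ else (fun (ee : Edge 3 L) => Matrix.of fun (i j : Fin 2) => ((y (ee, i, j, false) : ℝ) : ℂ) + ((y (ee, i, j, true) : ℝ) : ℂ) * Complex.I)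 a.1)).prod).trace.re) (coords x) - ∫ x, (fun y : (Edge 3 L × Fin 2 × Fin 2 × Bool → ℝ) => (([((q.1, q.2.1.1), false), ((Literature.MathematicalPhysics.QuantumFieldTheory.Site.shift q.1 q.2.1.1, q.2.1.2), false), ((Literature.MathematicalPhysics.QuantumFieldTheory.Site.shift q.1 q.2.1.2, q.2.1.1), true), ((q.1, q.2.1.2), true)].map (fun a : Edge 3 L × Bool => if a.2 then ((fun (ee : Edge 3 L) => Matrix.of fun (i j : Fin 2) => ((y (ee, i, j, false) : ℝ) : ℂ) + ((y (ee, i, j, true) : ℝ) : ℂ) * Complex.I) a.1)ᴴ else (fun (ee : Edge 3 L) => Matrix.of fun (i j : Fin 2) => ((y (ee, i, j, false) : ℝ) : ℂ) + ((y (ee, i, j, true) : ℝ) : ℂ) * Complex.I) a.1)).prod).trace.re) (coords x) ∂(wilsonMeasure (d := 3) (L := L) (fundamentalRep (Fin 2)) β')) * ((fun y : (Edge 3 L × Fin 2 × Fin 2 × Bool → ℝ) => (([((q'.1, q'.2.1.1), false), ((Literature.MathematicalPhysics.QuantumFieldTheory.Site.shift q'.1 q'.2.1.1, q'.2.1.2),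 false), ((Literature.MathematicalPhysics.QuantumFieldTheory.Site.shift q'.1 q'.2.1.2, q'.2.1.1), true), ((q'.1, q'.2.1.2), true)].map (fun a : Edge 3 L × Bool => if a.2 then ((fun (ee : Edge 3 L) => Matrix.of fun (i j : Fin 2) => ((y (ee, i, j, false) : ℝ) : ℂ) + ((y (ee, i, j, true) : ℝ) : ℂ) * Complex.I) a.1)ᴴ else (fun (ee : Edge 3 L) => Matrix.of fun (i j : Fin 2) => ((y (ee, i, j, false) : ℝ) : ℂ) + ((y (ee, i, j, true) : ℝ) : ℂ) * Complex.I) a.1)).prod).trace.re) (coords x) - ∫ x, (fun y : (Edge 3 L × Fin 2 × Fin 2 × Bool → ℝ) => (([((q'.1, q'.2.1.1), false), ((Literature.MathematicalPhysics.QuantumFieldTheory.Site.shift q'.1 q'.2.1.1, q'.2.1.2), false), ((Literature.MathematicalPhysics.QuantumFieldTheory.Site.shift q'.1 q'.2.1.2, q'.2.1.1), true), ((q'.1, q'.2.1.2), true)].map (fun a : Edge 3 L × Bool => if a.2 then ((fun (ee : Edge 3 L) => Matrix.of fun (i j : Fin 2) => ((y (ee, i, j, false) : ℝ) : ℂ)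 + ((y (ee, i, j, true) : ℝ) : ℂ) * Complex.I) a.1)ᴴ else (fun (ee : Edge 3 L) => Matrix.of fun (i j : Fin 2) => ((y (ee, i, j, false) : ℝ) : ℂ) + ((y (ee, i, j, true) : ℝ) : ℂ) * Complex.I) a.1)).prod).trace.re) (coords x) ∂(wilsonMeasure (d := 3) (L := L) (fundamentalRep (Fin 2)) β')) ∂(wilsonMeasure (d := 3) (L := L) (fundamentalRep (Fin 2)) β')| ≤ (4096 * Real.pi ^ 2 * ((l₁.length : ℝ) ^ 2 + 8) * (2 / (1 - 12 * |β'|)) * Real.exp (2 * ((1 - 12 * |β'|) * Real.log 108 / (2 * ((1300 + 4 * Real.sqrt 2) * |β'| + (1 - 12 * |β'|)))))) * Real.exp (-(((1 - 12 * |β'|) * Real.log 108 / (2 * ((1300 + 4 * Real.sqrt 2) * |β'| + (1 - 12 * |β'|)))) * (d : ℕ))) := by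
  intro coords
  classical
  have hlam0 : 0 ≤ (1300 + 4 * Real.sqrt 2) * |β'| := by positivity
  have hrho : 0 < (1 - 12 * |β'|) := by linarith
  have hrho1 : (1 - 12 * |β'|) ≤ 1 := by linarith [abs_nonneg β']
  have hden : 0 < (1300 + 4 * Real.sqrt 2) * |β'| + (1 - 12 * |β'|) := by linarith
  have hlog : 0 < Real.log 108 := Real.log_pos (by norm_num)
  have hκ : 0 ≤ ((1 - 12 * |β'|) * Real.log 108 / (2 * ((1300 + 4 * Real.sqrt 2) * |β'| + (1 - 12 * |β'|)))) := by positivity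
  have hlen : ∀ p : Plaquette 3 L, (([((p.1, p.2.1.1), false), ((Literature.MathematicalPhysics.QuantumFieldTheory.Site.shift p.1 p.2.1.1, p.2.1.2), false), ((Literature.MathematicalPhysics.QuantumFieldTheory.Site.shift p.1 p.2.1.2, p.2.1.1), true), ((p.1, p.2.1.2), true)] : List (Edge 3 L × Bool)).length : ℝ) = 4 := fun p => by norm_num
  by_cases hd3 : 3 ≤ d
  · obtain ⟨m, rfl⟩ := Nat.exists_eq_add_of_le' hd3
    have hsep : ∀ e' ∈ (l₁.map Prod.fst).toFinset ∪ ([((q.1, q.2.1.1), false), ((Literature.MathematicalPhysics.QuantumFieldTheory.Site.shift q.1 q.2.1.1, q.2.1.2), false), ((Literature.MathematicalPhysics.QuantumFieldTheory.Site.shift q.1 q.2.1.2, q.2.1.1), true), ((q.1, q.2.1.2), true)].map Prod.fst).toFinset, ∀ e ∈ ([((q'.1, q'.2.1.1), false), ((Literature.MathematicalPhysics.QuantumFieldTheory.Site.shift q'.1 q'.2.1.1, q'.2.1.2), false), ((Literature.MathematicalPhysics.QuantumFieldTheory.Site.shift q'.1 q'.2.1.2, q'.2.1.1), true), ((q'.1,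 q'.2.1.2), true)].map Prod.fst).toFinset,
        m + 1 ≤ (Finset.univ.sup fun i : Fin 3 => ((e'.1 i - e.1 i).valMinAbs).natAbs) := by
      intro e' he' e he
      have g1 := torusDist_plaquette_base_le q' e'.1 e he
      have c1 := torusDist_comm q'.1 e'.1
      have c2 := torusDist_comm e.1 e'.1
      rw [Finset.mem_union] at he'
      rcases he' with h1 | h2
      · have h := hdW e' h1
        omega
      · have g2 := torusDist_plaquette_base_le q q'.1 e' h2
        have h := hdq
        omega
    have key := wilson_threePoint_abs_le L β' hβ l₁ [((q.1, q.2.1.1), false), ((Literature.MathematicalPhysics.QuantumFieldTheory.Site.shift q.1 q.2.1.1, q.2.1.2), false), ((Literature.MathematicalPhysics.QuantumFieldTheory.Site.shift q.1 q.2.1.2, q.2.1.1), true), ((q.1, q.2.1.2), true)] [((q'.1, q'.2.1.1), false), ((Literature.MathematicalPhysics.QuantumFieldTheory.Site.shift q'.1 q'.2.1.1, q'.2.1.2), false), ((Literature.MathematicalPhysics.QuantumFieldTheory.Site.shift q'.1 q'.2.1.2, q'.2.1.1), true), ((q'.1, q'.2.1.2), true)] m hsep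
    refine key.trans ?_
    rw [hlen q, hlen q']
    have hdec := crossover_decay_le β' hβ m
    have hA : 128 * Real.pi ^ 2 * ((l₁.length : ℝ) ^ 2 + (4 : ℝ) ^ 2) * (4 : ℝ) ^ 2 ≤ 4096 * Real.pi ^ 2 * ((l₁.length : ℝ) ^ 2 + 8) := by
      nlinarith [Real.pi_pos, sq_nonneg (l₁.length : ℝ), sq_nonneg Real.pi]
    have hE0 : 0 ≤ (1 + (((m : ℝ) + 1) * Real.log 108 / ((1300 + 4 * Real.sqrt 2) * |β'| + (1 - 12 * |β'|)))) * Real.exp (-((1 - 12 * |β'|) * (((m : ℝ) + 1) * Real.log 108 / ((1300 + 4 * Real.sqrt 2) * |β'| + (1 - 12 * |β'|))))) := by positivity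
    calc 128 * Real.pi ^ 2 * ((l₁.length : ℝ) ^ 2 + (4 : ℝ) ^ 2) * (4 : ℝ) ^ 2 * (1 + (((m : ℝ) + 1) * Real.log 108 / ((1300 + 4 * Real.sqrt 2) * |β'| + (1 - 12 * |β'|)))) * Real.exp (-((1 - 12 * |β'|) * (((m : ℝ) + 1) * Real.log 108 / ((1300 + 4 * Real.sqrt 2) * |β'| + (1 - 12 * |β'|)))))
        = (128 * Real.pi ^ 2 * ((l₁.length : ℝ) ^ 2 + (4 : ℝ) ^ 2) * (4 : ℝ) ^ 2) * ((1 + (((m : ℝ) + 1) * Real.log 108 / ((1300 + 4 * Real.sqrt 2) * |β'| + (1 - 12 * |β'|)))) * Real.exp (-((1 - 12 * |β'|) * (((m : ℝ) + 1) * Real.log 108 / ((1300 + 4 * Real.sqrt 2) * |β'| + (1 - 12 * |β'|)))))) := by ring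
      _ ≤ (4096 * Real.pi ^ 2 * ((l₁.length : ℝ) ^ 2 + 8)) * ((2 / (1 - 12 * |β'|)) * Real.exp (2 * ((1 - 12 * |β'|) * Real.log 108 / (2 * ((1300 + 4 * Real.sqrt 2) * |β'| + (1 - 12 * |β'|))))) * Real.exp (-(((1 - 12 * |β'|) * Real.log 108 / (2 * ((1300 + 4 * Real.sqrt 2) * |β'| + (1 - 12 * |β'|)))) * (m + 3 : ℕ)))) :=
          mul_le_mul hA hdec hE0 (by positivity)
      _ = _ := by ring
  · push Not at hd3
    have key := wilson_threePoint_abs_le_trivial L β' l₁ [((q.1, q.2.1.1), false), ((Literature.MathematicalPhysics.QuantumFieldTheory.Site.shift q.1 q.2.1.1, q.2.1.2), false), ((Literature.MathematicalPhysics.QuantumFieldTheory.Site.shift q.1 q.2.1.2, q.2.1.1), true), ((q.1, q.2.1.2), true)] [((q'.1, q'.2.1.1), false), ((Literature.MathematicalPhysics.QuantumFieldTheory.Site.shift q'.1 q'.2.1.1, q'.2.1.2), false), ((Literature.MathematicalPhysics.QuantumFieldTheory.Site.shift q'.1 q'.2.1.2, q'.2.1.1), true), ((q'.1, q'.2.1.2),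 true)]
    refine key.trans ?_
    have hd2 : (d : ℝ) ≤ 2 := by exact_mod_cast Nat.lt_succ_iff.1 hd3
    have hE : 1 ≤ Real.exp (2 * ((1 - 12 * |β'|) * Real.log 108 / (2 * ((1300 + 4 * Real.sqrt 2) * |β'| + (1 - 12 * |β'|))))) * Real.exp (-(((1 - 12 * |β'|) * Real.log 108 / (2 * ((1300 + 4 * Real.sqrt 2) * |β'| + (1 - 12 * |β'|)))) * (d : ℕ))) := by
      rw [← Real.exp_add]
      exact Real.one_le_exp (by nlinarith)
    have hρ2 : 1 ≤ 2 / (1 - 12 * |β'|) := by rw [le_div_iff₀ hrho]; linarith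
    have hπ : 9 ≤ Real.pi ^ 2 := by nlinarith [Real.pi_gt_three]
    have hA : 64 ≤ 4096 * Real.pi ^ 2 * ((l₁.length : ℝ) ^ 2 + 8) := by nlinarith [sq_nonneg (l₁.length : ℝ)]
    calc (64 : ℝ) = 64 * 1 * 1 := by ring
      _ ≤ (4096 * Real.pi ^ 2 * ((l₁.length : ℝ) ^ 2 + 8)) * (2 / (1 - 12 * |β'|)) * (Real.exp (2 * ((1 - 12 * |β'|) * Real.log 108 / (2 * ((1300 + 4 * Real.sqrt 2) * |β'| + (1 - 12 * |β'|))))) * Real.exp (-(((1 - 12 * |β'|) * Real.log 108 / (2 * ((1300 + 4 * Real.sqrt 2) * |β'| + (1 - 12 * |β'|)))) * (d : ℕ)))) :=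
          mul_le_mul (mul_le_mul hA hρ2 (by norm_num) (by positivity)) hE (by norm_num) (by positivity)
      _ = _ := by ring

/-- ★★ **Isolating the loop**: if the base sites of `q` and of `q'` are at sup-distance `≥ d` from the base site of every link of `w`, then
`|⟨W̃ P̃_q P̃_q'⟩_(μ_β')| ≤ 4096π²(|w|²+8)(2/ρ)e^(2κ)·e^(−κd)` (`|β'| < 1/12`, every `L`). [folklore] -/
theorem threePoint_isolate_loop (L : ℕ) [NeZero L] (β' : ℝ) (hβ : |β'| < 1 / 12) (l₁ : List (Edge 3 L × Bool)) (q q' : Plaquette 3 L) (d : ℕ)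
    (hd1 : ∀ e ∈ (l₁.map Prod.fst).toFinset, d ≤ (Finset.univ.sup fun i : Fin 3 => ((e.1 i - q.1 i).valMinAbs).natAbs)) (hd2 : ∀ e ∈ (l₁.map Prod.fst).toFinset, d ≤ (Finset.univ.sup fun i : Fin 3 => ((e.1 i - q'.1 i).valMinAbs).natAbs)) :
    let coords : GaugeConfig 3 L (Matrix.specialUnitaryGroup (Fin 2) ℂ) → (Edge 3 L × Fin 2 × Fin 2 × Bool → ℝ) :=
      fun V q => (fun z : ℂ => if q.2.2.2 then z.im else z.re)
        ((fundamentalRep (Fin 2) (V q.1) : Matrix (Fin 2) (Fin 2) ℂ) q.2.1 q.2.2.1)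
    |∫ x, ((fun y : (Edge 3 L × Fin 2 × Fin 2 × Bool → ℝ) => ((l₁.map (fun a : Edge 3 L × Bool => if a.2 then ((fun (ee : Edge 3 L) => Matrix.of fun (i j : Fin 2) => ((y (ee, i, j, false) : ℝ) : ℂ) + ((y (ee, i, j, true) : ℝ) : ℂ) * Complex.I) a.1)ᴴ else (fun (ee : Edge 3 L) => Matrix.of fun (i j : Fin 2) => ((y (ee, i, j, false) : ℝ) : ℂ) + ((y (ee, i, j, true) : ℝ) : ℂ) * Complex.I) a.1)).prod).trace.re) (coords x) - ∫ x, (fun y : (Edge 3 L × Fin 2 × Fin 2 × Bool → ℝ) => ((l₁.map (fun a : Edge 3 L × Bool => if a.2 then ((fun (ee : Edge 3 L) => Matrix.of fun (i j : Fin 2) => ((y (ee, i, j, false) : ℝ) : ℂ) + ((y (ee, i, j, true) : ℝ) : ℂ) * Complex.I) a.1)ᴴ else (fun (ee : Edge 3 L) => Matrix.of fun (i j : Fin 2) => ((y (ee, i, j, false) : ℝ) : ℂ) + ((y (ee, i, j, true) : ℝ) : ℂ) * Complex.I) a.1)).prod).trace.re) (coords x) ∂(wilsonMeasure (d := 3)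 (L := L) (fundamentalRep (Fin 2)) β')) * ((fun y : (Edge 3 L × Fin 2 × Fin 2 × Bool → ℝ) => (([((q.1, q.2.1.1), false), ((Literature.MathematicalPhysics.QuantumFieldTheory.Site.shift q.1 q.2.1.1, q.2.1.2), false), ((Literature.MathematicalPhysics.QuantumFieldTheory.Site.shift q.1 q.2.1.2, q.2.1.1), true), ((q.1, q.2.1.2), true)].map (fun a : Edge 3 L × Bool => if a.2 then ((fun (ee : Edge 3 L) => Matrix.of fun (i j : Fin 2) => ((y (ee, i, j, false) : ℝ) : ℂ) + ((y (ee, i, j, true) : ℝ) : ℂ) * Complex.I) a.1)ᴴ else (fun (ee : Edge 3 L) => Matrix.of fun (i j : Fin 2) => ((y (ee, i, j, false) : ℝ) : ℂ) + ((y (ee, i, j, true) : ℝ) : ℂ) * Complex.I) a.1)).prod).trace.re) (coords x) - ∫ x, (fun y : (Edge 3 L × Fin 2 × Fin 2 × Bool → ℝ) => (([((q.1, q.2.1.1), false), ((Literature.MathematicalPhysics.QuantumFieldTheory.Site.shift q.1 q.2.1.1, q.2.1.2), false), ((Literature.MathematicalPhysics.QuantumFieldTheory.Site.shift q.1 q.2.1.2,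 q.2.1.1), true), ((q.1, q.2.1.2), true)].map (fun a : Edge 3 L × Bool => if a.2 then ((fun (ee : Edge 3 L) => Matrix.of fun (i j : Fin 2) => ((y (ee, i, j, false) : ℝ) : ℂ) + ((y (ee, i, j, true) : ℝ) : ℂ) * Complex.I) a.1)ᴴ else (fun (ee : Edge 3 L) => Matrix.of fun (i j : Fin 2) => ((y (ee, i, j, false) : ℝ) : ℂ) + ((y (ee, i, j, true) : ℝ) : ℂ) * Complex.I) a.1)).prod).trace.re) (coords x) ∂(wilsonMeasure (d := 3) (L := L) (fundamentalRep (Fin 2)) β')) * ((fun y : (Edge 3 L × Fin 2 × Fin 2 × Bool → ℝ) => (([((q'.1, q'.2.1.1), false), ((Literature.MathematicalPhysics.QuantumFieldTheory.Site.shift q'.1 q'.2.1.1, q'.2.1.2), false), ((Literature.MathematicalPhysics.QuantumFieldTheory.Site.shift q'.1 q'.2.1.2, q'.2.1.1), true), ((q'.1, q'.2.1.2), true)].map (fun a : Edge 3 L × Bool => if a.2 then ((fun (ee : Edge 3 L) => Matrix.of fun (i j : Fin 2) => ((y (ee, i, j, false) : ℝ) : ℂ) + ((y (ee, i, j, true)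 : ℝ) : ℂ) * Complex.I) a.1)ᴴ else (fun (ee : Edge 3 L) => Matrix.of fun (i j : Fin 2) => ((y (ee, i, j, false) : ℝ) : ℂ) + ((y (ee, i, j, true) : ℝ) : ℂ) * Complex.I) a.1)).prod).trace.re) (coords x) - ∫ x, (fun y : (Edge 3 L × Fin 2 × Fin 2 × Bool → ℝ) => (([((q'.1, q'.2.1.1), false), ((Literature.MathematicalPhysics.QuantumFieldTheory.Site.shift q'.1 q'.2.1.1, q'.2.1.2), false), ((Literature.MathematicalPhysics.QuantumFieldTheory.Site.shift q'.1 q'.2.1.2, q'.2.1.1), true), ((q'.1, q'.2.1.2), true)].map (fun a : Edge 3 L × Bool => if a.2 then ((fun (ee : Edge 3 L) => Matrix.of fun (i j : Fin 2) => ((y (ee, i, j, false) : ℝ) : ℂ) + ((y (ee, i, j, true) : ℝ) : ℂ) * Complex.I) a.1)ᴴ else (fun (ee : Edge 3 L) => Matrix.of fun (i j : Fin 2) => ((y (ee, i, j, false) : ℝ) : ℂ) + ((y (ee, i, j, true) : ℝ) : ℂ) * Complex.I) a.1)).prod).trace.re) (coords x) ∂(wilsonMeasure (d := 3) (L := L)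 (fundamentalRep (Fin 2)) β')) ∂(wilsonMeasure (d := 3) (L := L) (fundamentalRep (Fin 2)) β')| ≤ (4096 * Real.pi ^ 2 * ((l₁.length : ℝ) ^ 2 + 8) * (2 / (1 - 12 * |β'|)) * Real.exp (2 * ((1 - 12 * |β'|) * Real.log 108 / (2 * ((1300 + 4 * Real.sqrt 2) * |β'| + (1 - 12 * |β'|)))))) * Real.exp (-(((1 - 12 * |β'|) * Real.log 108 / (2 * ((1300 + 4 * Real.sqrt 2) * |β'| + (1 - 12 * |β'|)))) * (d : ℕ))) := by
  intro coords
  classical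
  have hlam0 : 0 ≤ (1300 + 4 * Real.sqrt 2) * |β'| := by positivity
  have hrho : 0 < (1 - 12 * |β'|) := by linarith
  have hrho1 : (1 - 12 * |β'|) ≤ 1 := by linarith [abs_nonneg β']
  have hden : 0 < (1300 + 4 * Real.sqrt 2) * |β'| + (1 - 12 * |β'|) := by linarith
  have hlog : 0 < Real.log 108 := Real.log_pos (by norm_num)
  have hκ : 0 ≤ ((1 - 12 * |β'|) * Real.log 108 / (2 * ((1300 + 4 * Real.sqrt 2) * |β'| + (1 - 12 * |β'|)))) := by positivity
  have hlen : ∀ p : Plaquette 3 L, (([((p.1, p.2.1.1), false), ((Literature.MathematicalPhysics.QuantumFieldTheory.Site.shift p.1 p.2.1.1, p.2.1.2), false), ((Literature.MathematicalPhysics.QuantumFieldTheory.Site.shift p.1 p.2.1.2, p.2.1.1), true), ((p.1, p.2.1.2), true)] : List (Edge 3 L × Bool)).length : ℝ) = 4 := fun p => by norm_num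
  -- reorder the factors: `W̃ P̃_q P̃_q' = P̃_q P̃_q' W̃`
  have hre : ∫ x, ((fun y : (Edge 3 L × Fin 2 × Fin 2 × Bool → ℝ) => ((l₁.map (fun a : Edge 3 L × Bool => if a.2 then ((fun (ee : Edge 3 L) => Matrix.of fun (i j : Fin 2) => ((y (ee, i, j, false) : ℝ) : ℂ) + ((y (ee, i, j, true) : ℝ) : ℂ) * Complex.I) a.1)ᴴ else (fun (ee : Edge 3 L) => Matrix.of fun (i j : Fin 2) => ((y (ee, i, j, false) : ℝ) : ℂ) + ((y (ee, i, j, true) : ℝ) : ℂ) * Complex.I) a.1)).prod).trace.re) (coords x) - ∫ x, (fun y : (Edge 3 L × Fin 2 × Fin 2 × Bool → ℝ) => ((l₁.map (fun a : Edge 3 L × Bool => if a.2 then ((fun (ee : Edge 3 L) => Matrix.of fun (i j : Fin 2) => ((y (ee, i, j, false) : ℝ) : ℂ) + ((y (ee, i, j, true) : ℝ) : ℂ) * Complex.I) a.1)ᴴ else (fun (ee : Edge 3 L) => Matrix.of fun (i j : Fin 2) => ((y (ee, i, j, false) : ℝ) : ℂ) + ((y (ee, i, j, true) : ℝ) : ℂ)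 * Complex.I) a.1)).prod).trace.re) (coords x) ∂(wilsonMeasure (d := 3) (L := L) (fundamentalRep (Fin 2)) β')) * ((fun y : (Edge 3 L × Fin 2 × Fin 2 × Bool → ℝ) => (([((q.1, q.2.1.1), false), ((Literature.MathematicalPhysics.QuantumFieldTheory.Site.shift q.1 q.2.1.1, q.2.1.2), false), ((Literature.MathematicalPhysics.QuantumFieldTheory.Site.shift q.1 q.2.1.2, q.2.1.1), true), ((q.1, q.2.1.2), true)].map (fun a : Edge 3 L × Bool => if a.2 then ((fun (ee : Edge 3 L) => Matrix.of fun (i j : Fin 2) => ((y (ee, i, j, false) : ℝ) : ℂ) + ((y (ee, i, j, true) : ℝ) : ℂ) * Complex.I) a.1)ᴴ else (fun (ee : Edge 3 L) => Matrix.of fun (i j : Fin 2) => ((y (ee, i, j, false) : ℝ) : ℂ) + ((y (ee, i, j, true) : ℝ) : ℂ) * Complex.I) a.1)).prod).trace.re) (coords x) - ∫ x, (fun y : (Edge 3 L × Fin 2 × Fin 2 × Bool → ℝ) => (([((q.1, q.2.1.1), false), ((Literature.MathematicalPhysics.QuantumFieldTheory.Site.shift q.1 q.2.1.1, q.2.1.2),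 false), ((Literature.MathematicalPhysics.QuantumFieldTheory.Site.shift q.1 q.2.1.2, q.2.1.1), true), ((q.1, q.2.1.2), true)].map (fun a : Edge 3 L × Bool => if a.2 then ((fun (ee : Edge 3 L) => Matrix.of fun (i j : Fin 2) => ((y (ee, i, j, false) : ℝ) : ℂ) + ((y (ee, i, j, true) : ℝ) : ℂ) * Complex.I) a.1)ᴴ else (fun (ee : Edge 3 L) => Matrix.of fun (i j : Fin 2) => ((y (ee, i, j, false) : ℝ) : ℂ) + ((y (ee, i, j, true) : ℝ) : ℂ) * Complex.I) a.1)).prod).trace.re) (coords x) ∂(wilsonMeasure (d := 3) (L := L) (fundamentalRep (Fin 2)) β')) * ((fun y : (Edge 3 L × Fin 2 × Fin 2 × Bool → ℝ) => (([((q'.1, q'.2.1.1), false), ((Literature.MathematicalPhysics.QuantumFieldTheory.Site.shift q'.1 q'.2.1.1, q'.2.1.2), false), ((Literature.MathematicalPhysics.QuantumFieldTheory.Site.shift q'.1 q'.2.1.2, q'.2.1.1), true), ((q'.1, q'.2.1.2), true)].map (fun a : Edge 3 L × Bool => if a.2 then ((fun (ee : Edge 3 L) => Matrix.of fun (i j :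 Fin 2) => ((y (ee, i, j, false) : ℝ) : ℂ) + ((y (ee, i, j, true) : ℝ) : ℂ) * Complex.I) a.1)ᴴ else (fun (ee : Edge 3 L) => Matrix.of fun (i j : Fin 2) => ((y (ee, i, j, false) : ℝ) : ℂ) + ((y (ee, i, j, true) : ℝ) : ℂ) * Complex.I) a.1)).prod).trace.re) (coords x) - ∫ x, (fun y : (Edge 3 L × Fin 2 × Fin 2 × Bool → ℝ) => (([((q'.1, q'.2.1.1), false), ((Literature.MathematicalPhysics.QuantumFieldTheory.Site.shift q'.1 q'.2.1.1, q'.2.1.2), false), ((Literature.MathematicalPhysics.QuantumFieldTheory.Site.shift q'.1 q'.2.1.2, q'.2.1.1), true), ((q'.1, q'.2.1.2), true)].map (fun a : Edge 3 L × Bool => if a.2 then ((fun (ee : Edge 3 L) => Matrix.of fun (i j : Fin 2) => ((y (ee, i, j, false) : ℝ) : ℂ) + ((y (ee, i, j, true) : ℝ) : ℂ) * Complex.I) a.1)ᴴ else (fun (ee : Edge 3 L) => Matrix.of fun (i j : Fin 2) => ((y (ee, i, j, false) : ℝ) : ℂ) + ((y (ee, i, j, true) : ℝ) : ℂ) * Complex.I)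 a.1)).prod).trace.re) (coords x) ∂(wilsonMeasure (d := 3) (L := L) (fundamentalRep (Fin 2)) β')) ∂(wilsonMeasure (d := 3) (L := L) (fundamentalRep (Fin 2)) β') = ∫ x, ((fun y : (Edge 3 L × Fin 2 × Fin 2 × Bool → ℝ) => (([((q.1, q.2.1.1), false), ((Literature.MathematicalPhysics.QuantumFieldTheory.Site.shift q.1 q.2.1.1, q.2.1.2), false), ((Literature.MathematicalPhysics.QuantumFieldTheory.Site.shift q.1 q.2.1.2, q.2.1.1), true), ((q.1, q.2.1.2), true)].map (fun a : Edge 3 L × Bool => if a.2 then ((fun (ee : Edge 3 L) => Matrix.of fun (i j : Fin 2) => ((y (ee, i, j, false) : ℝ) : ℂ) + ((y (ee, i, j, true) : ℝ) : ℂ) * Complex.I) a.1)ᴴ else (fun (ee : Edge 3 L) => Matrix.of fun (i j : Fin 2) => ((y (ee, i, j, false) : ℝ) : ℂ) + ((y (ee, i, j, true) : ℝ) : ℂ) * Complex.I) a.1)).prod).trace.re) (coords x) - ∫ x, (fun y : (Edge 3 L × Fin 2 × Fin 2 × Bool → ℝ) => (([((q.1, q.2.1.1), false), ((Literature.MathematicalPhysics.QuantumFieldTheory.Site.shift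 q.1 q.2.1.1, q.2.1.2), false), ((Literature.MathematicalPhysics.QuantumFieldTheory.Site.shift q.1 q.2.1.2, q.2.1.1), true), ((q.1, q.2.1.2), true)].map (fun a : Edge 3 L × Bool => if a.2 then ((fun (ee : Edge 3 L) => Matrix.of fun (i j : Fin 2) => ((y (ee, i, j, false) : ℝ) : ℂ) + ((y (ee, i, j, true) : ℝ) : ℂ) * Complex.I) a.1)ᴴ else (fun (ee : Edge 3 L) => Matrix.of fun (i j : Fin 2) => ((y (ee, i, j, false) : ℝ) : ℂ) + ((y (ee, i, j, true) : ℝ) : ℂ) * Complex.I) a.1)).prod).trace.re) (coords x) ∂(wilsonMeasure (d := 3) (L := L) (fundamentalRep (Fin 2)) β')) * ((fun y : (Edge 3 L × Fin 2 × Fin 2 × Bool → ℝ) => (([((q'.1, q'.2.1.1), false), ((Literature.MathematicalPhysics.QuantumFieldTheory.Site.shift q'.1 q'.2.1.1, q'.2.1.2), false), ((Literature.MathematicalPhysics.QuantumFieldTheory.Site.shift q'.1 q'.2.1.2, q'.2.1.1), true), ((q'.1, q'.2.1.2), true)].map (fun a : Edge 3 L × Bool => if a.2 then ((fun (ee : Edge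 3 L) => Matrix.of fun (i j : Fin 2) => ((y (ee, i, j, false) : ℝ) : ℂ) + ((y (ee, i, j, true) : ℝ) : ℂ) * Complex.I) a.1)ᴴ else (fun (ee : Edge 3 L) => Matrix.of fun (i j : Fin 2) => ((y (ee, i, j, false) : ℝ) : ℂ) + ((y (ee, i, j, true) : ℝ) : ℂ) * Complex.I) a.1)).prod).trace.re) (coords x) - ∫ x, (fun y : (Edge 3 L × Fin 2 × Fin 2 × Bool → ℝ) => (([((q'.1, q'.2.1.1), false), ((Literature.MathematicalPhysics.QuantumFieldTheory.Site.shift q'.1 q'.2.1.1, q'.2.1.2), false), ((Literature.MathematicalPhysics.QuantumFieldTheory.Site.shift q'.1 q'.2.1.2, q'.2.1.1), true), ((q'.1, q'.2.1.2), true)].map (fun a : Edge 3 L × Bool => if a.2 then ((fun (ee : Edge 3 L) => Matrix.of fun (i j : Fin 2) => ((y (ee, i, j, false) : ℝ) : ℂ) + ((y (ee, i, j, true) : ℝ) : ℂ) * Complex.I) a.1)ᴴ else (fun (ee : Edge 3 L) => Matrix.of fun (i j : Fin 2) => ((y (ee, i, j, false) : ℝ) : ℂ) + ((y (ee, i, j,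 true) : ℝ) : ℂ) * Complex.I) a.1)).prod).trace.re) (coords x) ∂(wilsonMeasure (d := 3) (L := L) (fundamentalRep (Fin 2)) β')) * ((fun y : (Edge 3 L × Fin 2 × Fin 2 × Bool → ℝ) => ((l₁.map (fun a : Edge 3 L × Bool => if a.2 then ((fun (ee : Edge 3 L) => Matrix.of fun (i j : Fin 2) => ((y (ee, i, j, false) : ℝ) : ℂ) + ((y (ee, i, j, true) : ℝ) : ℂ) * Complex.I) a.1)ᴴ else (fun (ee : Edge 3 L) => Matrix.of fun (i j : Fin 2) => ((y (ee, i, j, false) : ℝ) : ℂ) + ((y (ee, i, j, true) : ℝ) : ℂ) * Complex.I) a.1)).prod).trace.re) (coords x) - ∫ x, (fun y : (Edge 3 L × Fin 2 × Fin 2 × Bool → ℝ) => ((l₁.map (fun a : Edge 3 L × Bool => if a.2 then ((fun (ee : Edge 3 L) => Matrix.of fun (i j : Fin 2) => ((y (ee, i, j, false) : ℝ) : ℂ) + ((y (ee, i, j, true) : ℝ) : ℂ) * Complex.I) a.1)ᴴ else (fun (ee : Edge 3 L) => Matrix.of fun (i j : Fin 2) => ((y (ee, i, j, false) : ℝ)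 : ℂ) + ((y (ee, i, j, true) : ℝ) : ℂ) * Complex.I) a.1)).prod).trace.re) (coords x) ∂(wilsonMeasure (d := 3) (L := L) (fundamentalRep (Fin 2)) β')) ∂(wilsonMeasure (d := 3) (L := L) (fundamentalRep (Fin 2)) β') :=
    integral_congr_ae (ae_of_all _ fun x => by ring)
  rw [hre]
  by_cases hd3 : 3 ≤ d
  · obtain ⟨m, rfl⟩ := Nat.exists_eq_add_of_le' hd3
    have hsep : ∀ e' ∈ ([((q.1, q.2.1.1), false), ((Literature.MathematicalPhysics.QuantumFieldTheory.Site.shift q.1 q.2.1.1, q.2.1.2), false), ((Literature.MathematicalPhysics.QuantumFieldTheory.Site.shift q.1 q.2.1.2, q.2.1.1), true), ((q.1, q.2.1.2), true)].map Prod.fst).toFinset ∪ ([((q'.1, q'.2.1.1), false), ((Literature.MathematicalPhysics.QuantumFieldTheory.Site.shift q'.1 q'.2.1.1, q'.2.1.2), false), ((Literature.MathematicalPhysics.QuantumFieldTheory.Site.shift q'.1 q'.2.1.2, q'.2.1.1), true), ((q'.1, q'.2.1.2), true)].map Prod.fst).toFinset, ∀ e ∈ (l₁.map Prod.fst).toF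inset,
        m + 1 ≤ (Finset.univ.sup fun i : Fin 3 => ((e'.1 i - e.1 i).valMinAbs).natAbs) := by
      intro e' he' e he
      rw [Finset.mem_union] at he'
      rcases he' with h1 | h2
      · have g1 := torusDist_plaquette_base_le q e.1 e' h1
        have c1 := torusDist_comm q.1 e.1
        have h := hd1 e he
        omega
      · have g1 := torusDist_plaquette_base_le q' e.1 e' h2
        have c1 := torusDist_comm q'.1 e.1
        have h := hd2 e he
        omega
    have key := wilson_threePoint_abs_le L β' hβ [((q.1, q.2.1.1), false), ((Literature.MathematicalPhysics.QuantumFieldTheory.Site.shift q.1 q.2.1.1, q.2.1.2), false), ((Literature.MathematicalPhysics.QuantumFieldTheory.Site.shift q.1 q.2.1.2, q.2.1.1), true), ((q.1, q.2.1.2), true)] [((q'.1, q'.2.1.1), false), ((Literature.MathematicalPhysics.QuantumFieldTheory.Site.shift q'.1 q'.2.1.1, q'.2.1.2), false), ((Literature.MathematicalPhysics.QuantumFieldTheory.Site.shift q'.1 q'.2.1.2, q'.2.1.1), true), ((q'.1, q'.2.1.2), true)] l₁ m hsep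
    refine key.trans ?_
    rw [hlen q, hlen q']
    have hdec := crossover_decay_le β' hβ m
    have hA : 128 * Real.pi ^ 2 * ((4 : ℝ) ^ 2 + (4 : ℝ) ^ 2) * (l₁.length : ℝ) ^ 2 ≤ 4096 * Real.pi ^ 2 * ((l₁.length : ℝ) ^ 2 + 8) := by
      nlinarith [Real.pi_pos, sq_nonneg (l₁.length : ℝ), sq_nonneg Real.pi]
    have hE0 : 0 ≤ (1 + (((m : ℝ) + 1) * Real.log 108 / ((1300 + 4 * Real.sqrt 2) * |β'| + (1 - 12 * |β'|)))) * Real.exp (-((1 - 12 * |β'|) * (((m : ℝ) + 1) * Real.log 108 / ((1300 + 4 * Real.sqrt 2) * |β'| + (1 - 12 * |β'|))))) := by positivity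
    calc 128 * Real.pi ^ 2 * ((4 : ℝ) ^ 2 + (4 : ℝ) ^ 2) * (l₁.length : ℝ) ^ 2 * (1 + (((m : ℝ) + 1) * Real.log 108 / ((1300 + 4 * Real.sqrt 2) * |β'| + (1 - 12 * |β'|)))) * Real.exp (-((1 - 12 * |β'|) * (((m : ℝ) + 1) * Real.log 108 / ((1300 + 4 * Real.sqrt 2) * |β'| + (1 - 12 * |β'|)))))
        = (128 * Real.pi ^ 2 * ((4 : ℝ) ^ 2 + (4 : ℝ) ^ 2) * (l₁.length : ℝ) ^ 2) * ((1 + (((m : ℝ) + 1) * Real.log 108 / ((1300 + 4 * Real.sqrt 2) * |β'| + (1 - 12 * |β'|)))) * Real.exp (-((1 - 12 * |β'|) * (((m : ℝ) + 1) * Real.log 108 / ((1300 + 4 * Real.sqrt 2) * |β'| + (1 - 12 * |β'|)))))) := by ring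
      _ ≤ (4096 * Real.pi ^ 2 * ((l₁.length : ℝ) ^ 2 + 8)) * ((2 / (1 - 12 * |β'|)) * Real.exp (2 * ((1 - 12 * |β'|) * Real.log 108 / (2 * ((1300 + 4 * Real.sqrt 2) * |β'| + (1 - 12 * |β'|))))) * Real.exp (-(((1 - 12 * |β'|) * Real.log 108 / (2 * ((1300 + 4 * Real.sqrt 2) * |β'| + (1 - 12 * |β'|)))) * (m + 3 : ℕ)))) :=
          mul_le_mul hA hdec hE0 (by positivity)
      _ = _ := by ring
  · push Not at hd3
    have key := wilson_threePoint_abs_le_trivial L β' [((q.1, q.2.1.1), false), ((Literature.MathematicalPhysics.QuantumFieldTheory.Site.shift q.1 q.2.1.1, q.2.1.2), false), ((Literature.MathematicalPhysics.QuantumFieldTheory.Site.shift q.1 q.2.1.2, q.2.1.1), true), ((q.1, q.2.1.2), true)] [((q'.1, q'.2.1.1), false), ((Literature.MathematicalPhysics.QuantumFieldTheory.Site.shift q'.1 q'.2.1.1, q'.2.1.2), false), ((Literature.MathematicalPhysics.QuantumFieldTheory.Site.shift q'.1 q'.2.1.2, q'.2.1.1), true), ((q'.1, q'.2.1.2), true)]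 l₁
    refine key.trans ?_
    have hd2 : (d : ℝ) ≤ 2 := by exact_mod_cast Nat.lt_succ_iff.1 hd3
    have hE : 1 ≤ Real.exp (2 * ((1 - 12 * |β'|) * Real.log 108 / (2 * ((1300 + 4 * Real.sqrt 2) * |β'| + (1 - 12 * |β'|))))) * Real.exp (-(((1 - 12 * |β'|) * Real.log 108 / (2 * ((1300 + 4 * Real.sqrt 2) * |β'| + (1 - 12 * |β'|)))) * (d : ℕ))) := by
      rw [← Real.exp_add]
      exact Real.one_le_exp (by nlinarith)
    have hρ2 : 1 ≤ 2 / (1 - 12 * |β'|) := by rw [le_div_iff₀ hrho]; linarith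
    have hπ : 9 ≤ Real.pi ^ 2 := by nlinarith [Real.pi_gt_three]
    have hA : 64 ≤ 4096 * Real.pi ^ 2 * ((l₁.length : ℝ) ^ 2 + 8) := by nlinarith [sq_nonneg (l₁.length : ℝ)]
    calc (64 : ℝ) = 64 * 1 * 1 := by ring
      _ ≤ (4096 * Real.pi ^ 2 * ((l₁.length : ℝ) ^ 2 + 8)) * (2 / (1 - 12 * |β'|)) * (Real.exp (2 * ((1 - 12 * |β'|) * Real.log 108 / (2 * ((1300 + 4 * Real.sqrt 2) * |β'| + (1 - 12 * |β'|))))) * Real.exp (-(((1 - 12 * |β'|) * Real.log 108 / (2 * ((1300 + 4 * Real.sqrt 2) * |β'| + (1 - 12 * |β'|)))) * (d : ℕ)))) :=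
          mul_le_mul (mul_le_mul hA hρ2 (by norm_num) (by positivity)) hE (by norm_num) (by positivity)
      _ = _ := by ring

end Summit.QuantumFields.YangMills.Theorems.ColdStartUniversality.LiebRobinson
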